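/-
Copyright (c) 2026 the pub-hodgecm-mathlib formalisation cell (harness21).  Prover seat hodgecm-mathlib-R90-CS-p03 (g0) acting for R90-TF section S8 «ContSpec-n½» (planner R90-CS-plan (g0),
deal (c) «J3-LOCAL» 16:05:31Z of the S8B#4 road `R90/S8/CENSUS-R2chi-local.K2E1-p13-g3.md`): the HOLOMORPHY half of J3-local — the CHARACTER-WEIGHTED local and archimedean factors of
the `U(J₂)` intertwining scalar are holomorphic on `Re z > ½`, for ANY unimodular-bounded weight.
-/
import Summits.HodgeConjecture.HodgeConjecture.Theorems.K2E1IntertwiningLocalFactorIntegrableU2   -- ★ the spherical (`χ = 1`) originals: `integrable_archFactor_rpow_neg_of_half_lt`, `integrable_localFactor_rpow_neg_of_half_lt`, `differentiableOn_archMean`, `differentiableOn_localMean`; brings ★ FILE A `K2E1PowerMomentHolomorphy`, ★ `K2E1IntertwiningScalarEulerProductU2` tokens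
import HarnessLib

/-!
# K2·E1 ∕ R90·S8 — `K2E1ChiIntertwiningLocalFactorHolomorphicU2`: THE `χ`-WEIGHTED LOCAL AND ARCHIMEDEAN FACTORS OF THE `U(J₂)` INTERTWINING SCALAR ARE HOLOMORPHIC ON `Re z > ½`

Cell `pub/hodgecm-mathlib`, crux h413 = `stmt-HodgeConjecture-24833`, route of record `HCCMUnconditional`; R90-TF section S8 «ContSpec-n½», socket S8B#4 («`L²_res(U(Φ₂)) = ⊕ ℂ·ψ∘det`»), road
`R90/S8/CENSUS-R2chi-local.K2E1-p13-g3.md` item (J3): «poles of `qc` on `Re z > ½` ⊆ poles of `L^S(2z−1,χ₀)∕L^S(2z,χ₀)` ∪ poles of the finitely many bad∕archimedean factors; the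
bad-place factors are holomorphic (and non-vanishing) on `Re z > ½`».  THIS FILE is the HOLOMORPHY half, character-weight-GENERIC (J3 HEADS v1 of this seat, 16:1xZ).  THEOREMS ONLY (no
`def`, no `instance`, no notation, no named-fact hypothesis, no `sorry`; default heartbeats); lane `--supports stmt-HodgeConjecture-24833 --as helper` (count-neutral).  Closes no socket.

THE MATHEMATICS ([MoeglinWaldspurger1995] II.1.6–II.1.7, IV.1.11; [Langlands1976] Appendix; [Titchmarsh1939] §2.8).  CM pair `L ∕ L⁺`, `δ ∈ L⁻ ∖ 0`, `N = 2`.  On the `χ`-section of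
`U(J₂)` the local intertwining integral at a finite place `v` of `L⁺` unfolds, along the big cell `w₀ n(tδ)`, `t ∈ L⁺_v`, to `m_v(z) = ν_v(𝒪_v)⁻¹ ∫_{L⁺_v} ω_v(t) · P_v(t)^{−z} dν_v(t)` with the
spherical height `P_v(t) = ∏_{w∣v} max(1, ‖ι_w t‖_w‖δ‖_w) ≥ 1` of ★ `K2E1IntertwiningScalarEulerProductU2` and a WEIGHT `ω_v(t)` = the value of the unitary character `χ_w` on the torus
part of the Iwasawa decomposition of `w₀ n(tδ)` — a measurable function of modulus `≤ 1` (the exact token is the junction J1 with the K2Liu rank-one doubling currency ★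
`K2LiuGKRankOneValue.localSiegelCharacter_profile`, not fixed here).  Likewise the archimedean factor `c_∞(z) = μ_E(D_∞)⁻¹ ∫_{L⁺ ⊗ ℝ} ω_∞(s) · A(s)^{−z} dμ_E` with
`A(s) = ∏_{w∣∞}(1 + (wδ)² s_w²)`.  Since `‖ω‖ ≤ 1`, the weighted integrands are dominated by the UNweighted ones, which converge for `Re z > ½` (★ `integrable_localFactor_rpow_neg_of_half_lt`,
★ `integrable_archFactor_rpow_neg_of_half_lt`); holomorphy follows from dominated differentiation with the two-sided majorant `w^{−(σ₀+R)} + w^{−(σ₀−R)}` exactly as in the spherical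
case (★ FILE A `differentiableOn_integral_ofReal_cpow_neg`).  HENCE, for EVERY measurable weight of modulus `≤ 1` — in particular for every unitary `χ`, at EVERY place, ramified or not:
* §1 **`differentiableOn_integral_mul_ofReal_cpow_neg`** — the weighted moment `z ↦ ∫ ω·w^{−z} dm` is holomorphic on `{Re z > a}` when the real moments `∫ w^{−σ}`, `σ > a`, converge
  (threshold-`a`, complex-weight twin of ★ FILE A and of ★ `K2E1WhittakerTokenWindowU3.differentiableOn_integral_cpow_neg_mul_window`, whose threshold is hard-wired at `1`);
* §2 **`differentiableOn_chiLocalMean`** — `m_v(z) = ν_v(𝒪_v)⁻¹ ∫ ω_v · P_v^{−z}` is holomorphic on `{Re z > ½}` at every finite `v` (twin of ★ `differentiableOn_localMean`);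
* §3 **`differentiableOn_chiArchMean`** — `c_∞(z) = μ_E(D_∞)⁻¹ ∫ ω_∞ · A^{−z}` is holomorphic on `{Re z > ½}` (twin of ★ `differentiableOn_archMean`);
* §4 **`one_sub_mul_cpow_neg_ne_zero`**, **`chiLocalScalar_ne_zero_of_half_lt_re`** — the UNRAMIFIED `χ`-scalar `(1 − ε_v q_v^{−2z})(1 − ε_v q_v^{−(2z−1)})⁻¹` (`‖ε_v‖ ≤ 1`, `q_v ≥ 2`) is
  non-zero (and pole-free) on `{Re z > ½}` — the one factor kind whose NON-VANISHING is elementary (both `‖ε_v q_v^{−2z}‖, ‖ε_v q_v^{−(2z−1)}‖ < 1`); the tokens are those of ★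
  `K2E1ChiIntertwiningScalarEulerQuotientU2.hasProd_chiLocalScalar`.
HONEST SCOPE.  NOT here: non-vanishing of the BAD-place and ARCHIMEDEAN `χ`-factors on the half-plane (the spherical ★ `localMean_one_ne_zero` ∕ `archMean_one_ne_zero` are AT `z = 1` and BY
POSITIVITY, which a complex weight destroys; the `χ`-versions need the explicit shell ∕ Beta evaluation after J1 fixes the weight token — J3 HEADS v2).
HONEST LABEL: HC_CM is proved only modulo the 7 printed citations (2 remaining named inputs: hLiu418 = `stmt-HodgeConjecture-24832`, h413 = `stmt-HodgeConjecture-24833`) until rung 0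
closes; REL ≠ ★ ≠ BUILT; this file asserts no named fact and closes no socket; count-neutral.

## References
* [MoeglinWaldspurger1995] C. Mœglin, J.-L. Waldspurger, *Spectral Decomposition and Eisenstein Series* (1995), II.1.6–II.1.7, IV.1.11.
* [Langlands1976] R. P. Langlands, *On the Functional Equations Satisfied by Eisenstein Series*, LNM 544 (1976), Appendix.
* [Titchmarsh1939] E. C. Titchmarsh, *The Theory of Functions*, 2nd ed. (1939), §2.8.
* [Rogawski1990] J. D. Rogawski, *Automorphic Representations of Unitary Groups in Three Variables* (1990), §13.9 p. 229 (`M(s)` as an `L`-quotient).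
-/

set_option autoImplicit false
set_option linter.dupNamespace false -- the mandated namespace repeats `HodgeConjecture.HodgeConjecture`

noncomputable section

open MeasureTheory Measure NumberField NumberField.InfinitePlace NumberField.mixedEmbedding IsDedekindDomain IsDedekindDomain.HeightOneSpectrum Set Filter Function Topology Metric
open scoped ENNReal NNReal Classical
open Literature.NumberTheory.GaloisRepresentations.IsNonarchimedeanLocalField
open Literature.NumberTheory.Automorphic Literature.NumberTheory.Automorphic.UnitaryGroup AdelicGroupData Literature.NumberTheory.LFunctions
open Summit.HodgeConjecture.HodgeConjecture.Cruxes.H413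
open Summit.HodgeConjecture.HodgeConjecture.Cruxes.H413.K2E1PowerMomentHolomorphy (re_mem_Icc_of_mem_ball)
open Summit.HodgeConjecture.HodgeConjecture.Cruxes.H413.K2E1IntertwiningLocalFactorU2Line (continuous_prod_extension_max_one)
open Summit.HodgeConjecture.HodgeConjecture.Cruxes.H413.K2E1IntertwiningScalarEulerProductU2 (one_le_localHeight)
open Summit.HodgeConjecture.HodgeConjecture.Cruxes.H413.K2E1IntertwiningScalarLineIntegralU2 (archFactor_pos)
open Summit.HodgeConjecture.HodgeConjecture.Cruxes.H413.K2E1IntertwiningLocalFactorIntegrableU2 (integrable_archFactor_rpow_neg_of_half_lt integrable_localFactor_rpow_neg_of_half_lt)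

namespace Summit.HodgeConjecture.HodgeConjecture.Cruxes.H413.K2E1ChiIntertwiningLocalFactorHolomorphicU2

/-! ## §1 Engine: a weighted moment `z ↦ ∫ ω·w^{−z} dm` with `‖ω‖ ≤ 1` is holomorphic on the half-plane of convergence of the real moments -/

section Engine

variable {X : Type*} [MeasurableSpace X] {m : Measure X} {w : X → ℝ} {ω : X → ℂ}

/-- **WEIGHTED MOMENTS WITH NEGATIVE EXPONENT ARE HOLOMORPHIC.**  If `w > 0` and `ω` are measurable, `‖ω‖ ≤ 1`, and `∫ w^{−σ} dm < ∞` for every real `σ > a`, then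
`z ↦ ∫ ω(x)·w(x)^{−z} dm(x)` is holomorphic on `{Re z > a}` (dominated differentiation, ★ `Literature.Analysis.Complex.differentiableOn_integral_of_dominated`, with the majorant
`w^{−(σ₀+R)} + w^{−(σ₀−R)}`, `R = (σ₀ − a)∕2`, of the unweighted ★ `K2E1PowerMomentHolomorphy.differentiableOn_integral_ofReal_cpow_neg` — valid because `‖ω·w^{−z}‖ ≤ w^{−Re z}`).
[cite: Titchmarsh1939, §2.8] [cite: MoeglinWaldspurger1995, IV.1.11] -/
theorem differentiableOn_integral_mul_ofReal_cpow_neg (hw : Measurable w) (hw0 : ∀ x, 0 < w x) (hω : Measurable ω) (hωb : ∀ x, ‖ω x‖ ≤ 1)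
    {a : ℝ} (hint : ∀ σ : ℝ, a < σ → Integrable (fun x => w x ^ (-σ)) m) :
    DifferentiableOn ℂ (fun z => ∫ x, ω x * ((w x : ℝ) : ℂ) ^ (-z) ∂m) {z : ℂ | a < z.re} := by
  refine Literature.Analysis.Complex.differentiableOn_integral_of_dominated
    (fun z _ => (hω.mul (hw.complex_ofReal.pow_const (-z))).aestronglyMeasurable) (Eventually.of_forall fun x z _ => ?_) ?_
  · exact ((differentiableAt_id.neg.const_cpow (Or.inl (Complex.ofReal_ne_zero.mpr (hw0 x).ne'))).const_mul _).differentiableWithinAt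
  · intro z₀ hz₀
    have hz₀' : a < z₀.re := hz₀
    set R : ℝ := (z₀.re - a) / 2 with hR
    have hRpos : 0 < R := by rw [hR]; linarith
    refine ⟨R, hRpos, fun z hz => ?_, fun x => w x ^ (-(z₀.re + R)) + w x ^ (-(z₀.re - R)),
      (hint _ (by rw [hR]; linarith)).add (hint _ (by rw [hR]; linarith)), ?_⟩
    · show a < z.re
      have := (re_mem_Icc_of_mem_ball hz).1
      rw [hR] at this
      linarith
    · refine Eventually.of_forall fun x z hz => ?_
      rw [norm_mul, Complex.norm_cpow_eq_rpow_re_of_pos (hw0 x), Complex.neg_re]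
      calc ‖ω x‖ * w x ^ (-z.re) ≤ 1 * w x ^ (-z.re) :=
            mul_le_mul_of_nonneg_right (hωb x) (Real.rpow_nonneg (hw0 x).le _)
        _ = w x ^ (-z.re) := one_mul _
        _ ≤ w x ^ (-(z₀.re + R)) + w x ^ (-(z₀.re - R)) :=
            rpow_le_rpow_add_rpow_of_le_of_le (hw0 x) (neg_le_neg (re_mem_Icc_of_mem_ball hz).2) (neg_le_neg (re_mem_Icc_of_mem_ball hz).1)

end Engine

/-! ## §2 The `χ`-weighted LOCAL factor is holomorphic on `{Re z > ½}` at every finite place -/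

section Local

variable (L : Type) [Field L] [NumberField L] [IsCMField L] {δ : L} (hδ : δ ≠ 0)

include hδ in
/-- **`m_v(z) = ν_v(𝒪_v)⁻¹·∫_{L⁺_v} ω_v(t) · P_v(t)^{−z} dν_v` is holomorphic on `{Re z > ½}`, for EVERY measurable weight `ω_v : L⁺_v → ℂ` with `‖ω_v‖ ≤ 1`** — the `χ`-twisted
local intertwining factor of `U(J₂)` at ANY finite place `v` of `L⁺` (unramified, ramified for `χ`, or bad for `δ` alike), `ω_v` being the value of the unitary `χ_w` on the torus part of
`w₀ n(tδ)`.  Twin of the spherical ★ `K2E1IntertwiningLocalFactorIntegrableU2.differentiableOn_localMean` (§1 engine + ★ `integrable_localFactor_rpow_neg_of_half_lt`).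
[cite: Langlands1976, Appendix] [cite: MoeglinWaldspurger1995, IV.1.11] -/
theorem differentiableOn_chiLocalMean (v : HeightOneSpectrum (𝓞 ↥(maximalRealSubfield L)))
    [MeasurableSpace (v.adicCompletion ↥(maximalRealSubfield L))] [BorelSpace (v.adicCompletion ↥(maximalRealSubfield L))]
    (μ : Measure (v.adicCompletion ↥(maximalRealSubfield L))) [μ.IsAddHaarMeasure]
    (ω : v.adicCompletion ↥(maximalRealSubfield L) → ℂ) (hω : Measurable ω) (hωb : ∀ t, ‖ω t‖ ≤ 1) :
    DifferentiableOn ℂ (fun z : ℂ => ((((μ (v.adicCompletionIntegers ↥(maximalRealSubfield L))).toReal⁻¹ : ℝ)) : ℂ) *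
      ∫ t : v.adicCompletion ↥(maximalRealSubfield L), ω t * ((((letI := Extension.fintype (𝓞 ↥(maximalRealSubfield L)) ↥(maximalRealSubfield L) L (𝓞 L) v; ∏ w : v.Extension (𝓞 L), max 1 (normAbs (w.1.adicCompletion L) (Extension.adicCompletionSemialgHom ↥(maximalRealSubfield L) L w t) * normAbs (w.1.adicCompletion L) ((algebraMap L (FiniteAdeleRing (𝓞 L) L) δ) w.1))) : ℝ≥0) : ℝ) : ℂ) ^ (-z) ∂μ) {z : ℂ | 1 / 2 < z.re} := by
  letI := Extension.fintype (𝓞 ↥(maximalRealSubfield L)) ↥(maximalRealSubfield L) L (𝓞 L) v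
  have hmeas : Measurable fun t : v.adicCompletion ↥(maximalRealSubfield L) => (((letI := Extension.fintype (𝓞 ↥(maximalRealSubfield L)) ↥(maximalRealSubfield L) L (𝓞 L) v; ∏ w : v.Extension (𝓞 L), max 1 (normAbs (w.1.adicCompletion L) (Extension.adicCompletionSemialgHom ↥(maximalRealSubfield L) L w t) * normAbs (w.1.adicCompletion L) ((algebraMap L (FiniteAdeleRing (𝓞 L) L) δ) w.1))) : ℝ≥0) : ℝ) :=
    (NNReal.continuous_coe.comp (continuous_prod_extension_max_one (E := L) (δ := δ) v)).measurable
  exact (differentiableOn_integral_mul_ofReal_cpow_neg hmeas (fun t => lt_of_lt_of_le zero_lt_one (by exact_mod_cast one_le_localHeight L v t)) hω hωb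
    fun σ hσ => integrable_localFactor_rpow_neg_of_half_lt L hδ v μ hσ).const_mul _

end Local

/-! ## §3 The `χ`-weighted ARCHIMEDEAN factor is holomorphic on `{Re z > ½}` -/

section Arch

variable (L : Type) [Field L] [NumberField L] [IsCMField L] {δ : L} (hδ : δ ≠ 0)

include hδ in
/-- **`c_∞(z) = μ_E(D_∞)⁻¹·∫_{L⁺⊗ℝ} ω_∞(s) · A(s)^{−z} dμ_E` is holomorphic on `{Re z > ½}`, for EVERY measurable weight `ω_∞ : L⁺ ⊗ ℝ → ℂ` with `‖ω_∞‖ ≤ 1`** — the `χ`-twisted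
archimedean intertwining factor of `U(J₂)` (`ω_∞` = the value of `χ_∞` on the torus part along the big-cell line).  Twin of the spherical ★
`K2E1IntertwiningLocalFactorIntegrableU2.differentiableOn_archMean` (§1 engine + ★ `integrable_archFactor_rpow_neg_of_half_lt`). [cite: MoeglinWaldspurger1995, IV.1.11] [cite: Titchmarsh1939, §2.8] -/
theorem differentiableOn_chiArchMean (μE : Measure (mixedSpace ↥(maximalRealSubfield L))) [μE.IsAddHaarMeasure]
    (ω : mixedSpace ↥(maximalRealSubfield L) → ℂ) (hω : Measurable ω) (hωb : ∀ s, ‖ω s‖ ≤ 1) :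
    DifferentiableOn ℂ (fun z : ℂ => ((((μE (ZSpan.fundamentalDomain (latticeBasis ↥(maximalRealSubfield L)))).toReal⁻¹ : ℝ)) : ℂ) *
      ∫ s : mixedSpace ↥(maximalRealSubfield L), ω s * (((∏ w : InfinitePlace L, ((1 : ℝ) + (w δ) ^ 2 * (s.1 ⟨w.comap (algebraMap ↥(maximalRealSubfield L) L), K2E1HeightBigCellLineFormulaU2.isReal_comap_maximalRealSubfield L w⟩) ^ 2)) : ℝ) : ℂ) ^ (-z) ∂μE) {z : ℂ | 1 / 2 < z.re} := by
  have hcont : Continuous fun s : mixedSpace ↥(maximalRealSubfield L) => (∏ w : InfinitePlace L, ((1 : ℝ) + (w δ) ^ 2 * (s.1 ⟨w.comap (algebraMap ↥(maximalRealSubfield L) L), K2E1HeightBigCellLineFormulaU2.isReal_comap_maximalRealSubfield L w⟩) ^ 2)) := by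
    refine continuous_finsetProd _ fun w _ => ?_
    exact continuous_const.add (continuous_const.mul (((continuous_apply _).comp continuous_fst).pow 2))
  exact (differentiableOn_integral_mul_ofReal_cpow_neg hcont.measurable (archFactor_pos L) hω hωb fun σ hσ => integrable_archFactor_rpow_neg_of_half_lt L hδ μE hσ).const_mul _

end Arch

/-! ## §4 The UNRAMIFIED `χ`-scalar `(1 − ε_v q_v^{−2z})(1 − ε_v q_v^{−(2z−1)})⁻¹` is non-zero and pole-free on `{Re z > ½}` -/

section Unramified

/-- **`1 − ε·q^{−s} ≠ 0` when `‖ε‖ ≤ 1`, `q ≥ 2` and `Re s > 0`**: `‖ε·q^{−s}‖ ≤ q^{−Re s} < 1`. [cite: Rogawski1990, §13.9 p. 229] -/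
theorem one_sub_mul_cpow_neg_ne_zero {ε : ℂ} (hε : ‖ε‖ ≤ 1) {q : ℕ} (hq : 2 ≤ q) {s : ℂ} (hs : 0 < s.re) :
    1 - ε * (q : ℂ) ^ (-s) ≠ 0 := by
  have hq0 : (0 : ℝ) < q := by exact_mod_cast (lt_of_lt_of_le zero_lt_two hq)
  have hq1 : (1 : ℝ) < q := by exact_mod_cast (lt_of_lt_of_le one_lt_two hq)
  have hnorm : ‖ε * (q : ℂ) ^ (-s)‖ < 1 := by
    rw [norm_mul, show ((q : ℂ)) = ((q : ℝ) : ℂ) by norm_cast, Complex.norm_cpow_eq_rpow_re_of_pos hq0, Complex.neg_re]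
    calc ‖ε‖ * (q : ℝ) ^ (-s.re) ≤ 1 * (q : ℝ) ^ (-s.re) := mul_le_mul_of_nonneg_right hε (Real.rpow_nonneg hq0.le _)
      _ = (q : ℝ) ^ (-s.re) := one_mul _
      _ < 1 := Real.rpow_lt_one_of_one_lt_of_neg hq1 (by linarith)
  intro h
  have h1 : ε * (q : ℂ) ^ (-s) = 1 := (sub_eq_zero.mp h).symm
  rw [h1, norm_one] at hnorm
  exact lt_irrefl _ hnorm

/-- **THE UNRAMIFIED `χ`-SCALAR IS NON-ZERO ON `{Re z > ½}`**: for `‖ε_v‖ ≤ 1` (a unitary character value, ★ `norm_valueAtUniformizer_le_one`) and `q_v ≥ 2`,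
`(1 − ε_v q_v^{−2z})·(1 − ε_v q_v^{−(2z−1)})⁻¹ ≠ 0` whenever `Re z > ½` — both `1 − ε_v q_v^{−2z}` (`Re 2z > 1 > 0`) and `1 − ε_v q_v^{−(2z−1)}` (`Re (2z−1) > 0`) are non-zero by
`one_sub_mul_cpow_neg_ne_zero`, so the quotient is a non-zero complex number (no pole either).  The tokens are those of ★ `K2E1ChiIntertwiningScalarEulerQuotientU2.hasProd_chiLocalScalar`
(`L_v(2z−1, χ₀)∕L_v(2z, χ₀)`). [cite: Rogawski1990, §13.9 p. 229] [cite: Langlands1976, Appendix] -/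
theorem chiLocalScalar_ne_zero_of_half_lt_re {ε : ℂ} (hε : ‖ε‖ ≤ 1) {q : ℕ} (hq : 2 ≤ q) {z : ℂ} (hz : 1 / 2 < z.re) :
    (1 - ε * (q : ℂ) ^ (-(2 * z))) * (1 - ε * (q : ℂ) ^ (-(2 * z - 1)))⁻¹ ≠ 0 := by
  have h2 : 0 < (2 * z).re := by
    rw [Complex.mul_re]; norm_num; linarith
  have h21 : 0 < (2 * z - 1).re := by
    rw [Complex.sub_re, Complex.mul_re, Complex.one_re]; norm_num; linarith
  exact mul_ne_zero (one_sub_mul_cpow_neg_ne_zero hε hq h2) (inv_ne_zero (one_sub_mul_cpow_neg_ne_zero hε hq h21))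

end Unramified

end Summit.HodgeConjecture.HodgeConjecture.Cruxes.H413.K2E1ChiIntertwiningLocalFactorHolomorphicU2

end
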